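import Summits.HodgeConjecture.HodgeConjecture.Theorems.EightfoldBlochSeedsChernCharacterOnBettiAnalytificationVectorBundle
import Literature.AlgebraicTopology.SingularHomology.CupProductProofs
import Literature.AlgebraicGeometry.HodgeTheory.ChernCharacterBetti
import HarnessLib

/-!
# K1 (analytification bridge): the Chern character of a LINE bundle is `exp(c₁)` — `ch_k = c₁ᵏ / k!`
# in the tree's `cupPowTwo` spelling (field `ch_of_hasRankLE_one` of `ChernCharacterBetti`)

Route `EightfoldBlochSeeds` / item `stmt-HodgeConjecture-19780` (`ChernCharacterOnBetti`), helper
(`--supports`). HONEST FRAMING: nothing here proves 19780 / 18880 / 18882 / 18883 / H2 / HC_AV / HC;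
no definition, no named fact.

WHAT. The tree's recursion `topologicalChernCharacter_succ_of_rank_le_one`
(`ch_{k+1}(L) = (k+1)⁻¹ · c₁(L) ⌣ ch_k(L)` for `rank L ≤ 1`, Hirzebruch §10.1 "if `q = 1` and `c₁(ξ) = d`
then `ch(ξ) = e^d`") multiplies by `c₁` on the LEFT, while the field `ch_of_hasRankLE_one` of
`ChernCharacterBetti` is spelled with `HodgeTheory.cupPowTwo x k` (`xᵏ⁺¹ = xᵏ ⌣ x`, multiplication on
the right). Graded commutativity of the cup product in even degrees (Hatcher Thm. 3.11, the tree's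
THEOREM `cupProduct_gradedComm_holds`) identifies the two:

* `topologicalChernCharacter_eq_cupPowTwo_of_rank_le_one` — for a complex vector bundle `L` of rank
  `≤ 1` on any base and `k ≥ 1`: `ch_k(L) = (k!)⁻¹ • cupPowTwo (ch₁(L)) k` in `H²ᵏ(B; ℂ)`;
* `exists_analytification_ch_of_hasRankLE_one` — for an `𝒪_X`-module `L` with `HasRankLE L 1` on a
  smooth projective `X`: an analytification datum of rank `≤ 1` exists (K1d) and its Chern character
  satisfies the displayed identity (the field `ch_of_hasRankLE_one`).

[cite: Hirzebruch1966, §10.1] [cite: HatcherAT2002, Thm. 3.11] [cite: Fulton1998, §15.1 (iii)]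
-/

noncomputable section

-- single-problem summit (Problem = Summit): the mandated namespace repeats `HodgeConjecture`.
set_option linter.dupNamespace false

open CategoryTheory AlgebraicGeometry Bundle Topology
open Literature.AlgebraicGeometry.Motives Literature.AlgebraicGeometry.HodgeTheory
open Literature.AlgebraicTopology.SingularHomology Literature.AlgebraicTopology.CharacteristicClasses

namespace Summit.HodgeConjecture.HodgeConjecture.Theorems

/-- **`ch_k(L) = c₁(L)ᵏ / k!` for a line bundle**, in the `cupPowTwo` spelling: for a complex vector
bundle `L` of rank `≤ 1` and `k ≥ 1`,
`ch_k(L) = (k!)⁻¹ • cupPowTwo (ch₁(L)) k` (`ch₁ = c₁`; induction on `k` with the tree's recursion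
`ch_{k+1} = (k+1)⁻¹ c₁ ⌣ ch_k` and graded commutativity in even degrees).
[cite: Hirzebruch1966, §10.1] [cite: HatcherAT2002, Thm. 3.11] -/
theorem topologicalChernCharacter_eq_cupPowTwo_of_rank_le_one {B : Type} [TopologicalSpace B]
    (L : ComplexVectorBundle.{0, 0} B) (hL : L.rank ≤ 1) :
    ∀ {k : ℕ}, 1 ≤ k → theChernClassTheory.topologicalChernCharacter ℂ L k =
      ((Nat.factorial k : ℕ) : ℂ)⁻¹ • cupPowTwo (theChernClassTheory.topologicalChernCharacter ℂ L 1) k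
  | 0, h => absurd h (by omega)
  | 1, _ => by rw [cupPowTwo_one, Nat.factorial_one, Nat.cast_one, inv_one, one_smul]
  | k + 2, _ => by
    have ih := topologicalChernCharacter_eq_cupPowTwo_of_rank_le_one L hL (k := k + 1) (by omega)
    rw [theChernClassTheory.topologicalChernCharacter_succ_of_rank_le_one ℂ L hL (k + 1) (by omega), ih,
      ← theChernClassTheory.topologicalChernCharacter_one ℂ L, LinearMap.map_smul, cupPowTwo_succ, smul_smul]
    -- graded commutativity in even degrees: `c₁ ⌣ y = y ⌣ c₁`
    have hcomm := cupProduct_gradedComm_holds ℂ B (two_mul_add_two_mul (Nat.add_comm 1 (k + 1)))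
      (two_mul_add_two (k + 1)) (theChernClassTheory.topologicalChernCharacter ℂ L 1)
      (cupPowTwo (theChernClassTheory.topologicalChernCharacter ℂ L 1) (k + 1))
    have hsign : ((-1 : ℂ) ^ (2 * 1 * (2 * (k + 1)))) = 1 := by
      rw [show 2 * 1 * (2 * (k + 1)) = 2 * (2 * (k + 1)) by ring, pow_mul, neg_one_sq, one_pow]
    rw [hsign, one_smul] at hcomm
    change _ • cupProduct (two_mul_add_two_mul (Nat.add_comm 1 (k + 1)))
      (theChernClassTheory.topologicalChernCharacter ℂ L 1)
      (cupPowTwo (theChernClassTheory.topologicalChernCharacter ℂ L 1) (k + 1)) = _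
    rw [hcomm]
    congr 1
    rw [Nat.factorial_succ (k + 1), Nat.cast_mul, mul_inv]

variable {n : ℕ} {X : SchemeOver ℂ} {F : X.left.Modules}

/-- **`ch_of_hasRankLE_one` for analytifications**: an `𝒪_X`-module `L` with `HasRankLE L 1` on a smooth
projective `X` has an analytification datum `(E, α)` of rank `≤ 1` (K1d), and
`ch_i(E) = (i!)⁻¹ • cupPowTwo (ch₁(E)) i` for `0 < i`. [cite: Fulton1998, §15.1 (iii)] [cite: Hirzebruch1966, §10.1] -/
theorem exists_analytification_ch_of_hasRankLE_one (hX : IsSmoothProjective n X) (hF : HasRankLE F 1) :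
    ∃ (r : ℕ) (E : ComplexVectorBundle.{0, 0} (ComplexPoints X))
      (α : ∀ U : X.left.Opens, Γ(F, U) → ∀ P : ComplexPoints X, E.E P),
      r ≤ 1 ∧ E.rank = r ∧
      (∀ x : X.left, ∃ (U : X.left.Opens) (s : Fin r → Γ(F, U)), x ∈ U ∧ IsSectionFrame F U s) ∧
      (∀ (U : X.left.Opens) (σ : Γ(F, U)),
          ContinuousOn (fun P ↦ (⟨P, α U σ P⟩ : TotalSpace E.F E.E)) {P | P.pt ∈ U}) ∧
      (∀ (U : X.left.Opens) (t : Fin r → Γ(F, U)), IsSectionFrame F U t → ∀ P : ComplexPoints X,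
          P.pt ∈ U → LinearIndependent ℂ (fun j ↦ α U (t j) P) ∧
            ⊤ ≤ Submodule.span ℂ (Set.range fun j ↦ α U (t j) P)) ∧
      (∀ i : ℕ, 0 < i → (theChernClassTheory.topologicalChernCharacter ℂ E i : complexBetti X (2 * i)) =
        ((Nat.factorial i : ℕ) : ℂ)⁻¹ • cupPowTwo (theChernClassTheory.topologicalChernCharacter ℂ E 1) i) := by
  obtain ⟨r, E, α, hr, hrank, hfr, -, -, -, hcont, hframe⟩ := exists_topologicalAnalytification_of_hasRankLE hX hF
  exact ⟨r, E, α, hr, hrank, hfr, hcont, hframe, fun i hi ↦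
    topologicalChernCharacter_eq_cupPowTwo_of_rank_le_one E (hrank ▸ hr) hi⟩

end Summit.HodgeConjecture.HodgeConjecture.Theorems

end
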